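import Summits.ValiantsHypothesis.ValiantsHypothesis.Theorems.LacunarySymmetroidMatrixDescartesCensusV20SoundCerts
import Summits.ValiantsHypothesis.ValiantsHypothesis.Theorems.LacunarySymmetroidMatrixDescartesCensusSignClass
import Summits.ValiantsHypothesis.ValiantsHypothesis.Theorems.LacunarySymmetroidMatrixDescartesCensusBoxKit

/-!
# `MatrixDescartes` census — soundness of the `V = 20` certificate checker: the Gram inequalities `G3, RCS, W ≥ 0` and the definite triangle, in matrix entries

HONEST FRAMING.  Object-search cell `pub-symmetroid`; door-A item `DoorA26 = PosRootLawAt 2 6 19`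
(stmt-ValiantsHypothesis-19979; OPEN, typed, never asserted).  Part of the proof that a certificate accepted by `V20.checkCell` (`…CensusV20Check`) excludes a twenty — `20 = D(2,6)` distinct
positive det-roots of a six-term real symmetric `2 × 2` pencil — on its support (semantics: `…CensusV20Model`).  Nothing here bears on `V = 19`, on `ζ_sym(2,6)` over all supports, on `DoorA26` itself, on `MatrixDescartes`
(stmt-ValiantsHypothesis-18050) or on `VP ≠ VNP`.

[folklore] Certificate-checker soundness / replay; elementary.
-/

-- the D-0017 layout repeats a namespace component (single-conjunct summit); the `dupNamespace` linter flags it; name mandated.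
set_option linter.dupNamespace false

namespace Summit.ValiantsHypothesis.ValiantsHypothesis.Theorems.LacunarySymmetroidMatrixDescartes.Census.V20

/-! ## Soundness, concrete layer: a hypothetical twenty on a checked support yields a model -/

section Twenty

open Polynomial Finset
open scoped BigOperators Polynomial Matrix

/-- `fin6` below `6`. [folklore] -/
theorem fin6_eq {i : ℕ} (h : i < 6) : fin6 i = ⟨i, h⟩ := Fin.ext (Nat.mod_eq_of_lt h)

/-- `bv` is symmetric. [folklore] -/
theorem bv_comm (S : Fin 6 → Matrix (Fin 2) (Fin 2) ℝ) (i j : ℕ) : bv S i j = bv S j i := by unfold bv; ring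

/-- Value of a diagonal atom. [folklore] -/
theorem aval_qA (S : Fin 6 → Matrix (Fin 2) (Fin 2) ℝ) (i : ℕ) : aval S (qA i) = qv S i := by simp [aval, qA]

/-- Value of an off-diagonal atom. [folklore] -/
theorem aval_cA (S : Fin 6 → Matrix (Fin 2) (Fin 2) ℝ) {i j : ℕ} (h : i ≠ j) : aval S (cA i j) = bv S i j := by
  unfold cA
  split_ifs with h1
  · simp [aval, h]
  · simp [aval, Ne.symm h, bv_comm S j i]

/-! ### The Gram inequalities in entries -/

/-- `G3 ≥ 0` in entries (half a `3 × 3` Minkowski Gram determinant is a square). [folklore] -/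
theorem pval_G3 (S : Fin 6 → Matrix (Fin 2) (Fin 2) ℝ) {i j k : ℕ} (hij : i < j) (hjk : j < k) :
    0 ≤ pval (aval S) (G3poly i j k) := by
  have e : pval (aval S) (G3poly i j k) = 4 * qv S i * qv S j * qv S k + bv S i j * bv S j k * bv S i k
      - qv S i * bv S j k ^ 2 - qv S j * bv S i k ^ 2 - qv S k * bv S i j ^ 2 := by
    simp only [pval, tval, G3poly, List.map_cons, List.map_nil, List.sum_cons, List.sum_nil, List.prod_cons,
      List.prod_nil, aval_qA, aval_cA S hij.ne, aval_cA S hjk.ne, aval_cA S (hij.trans hjk).ne]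
    push_cast; ring
  rw [e]
  have h := g3_nonneg (S (fin6 i) 0 0) (S (fin6 i) 0 1) (S (fin6 i) 1 1) (S (fin6 j) 0 0) (S (fin6 j) 0 1) (S (fin6 j) 1 1)
    (S (fin6 k) 0 0) (S (fin6 k) 0 1) (S (fin6 k) 1 1)
  unfold qv bv
  linarith

/-- `RCS ≥ 0` in entries for a definite first letter (reverse Cauchy–Schwarz). [folklore] -/
theorem pval_RCS (S : Fin 6 → Matrix (Fin 2) (Fin 2) ℝ) {i j : ℕ} (hij : i ≠ j) (hq : 0 < aval S (qA i)) :
    0 ≤ pval (aval S) (RCSpoly i j) := by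
  have e : pval (aval S) (RCSpoly i j) = bv S i j ^ 2 - 4 * qv S i * qv S j := by
    simp only [pval, tval, RCSpoly, List.map_cons, List.map_nil, List.sum_cons, List.sum_nil, List.prod_cons,
      List.prod_nil, aval_qA, aval_cA S hij]
    push_cast; ring
  rw [e]
  rw [aval_qA] at hq
  have h := four_det_mul_det_le_polarDet_sq (S (fin6 i) 0 0) (S (fin6 i) 0 1) (S (fin6 i) 1 1)
    (S (fin6 j) 0 0) (S (fin6 j) 0 1) (S (fin6 j) 1 1) (by unfold qv at hq; exact hq)
  unfold qv bv
  linarith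

/-- The generic expansion of `G3(u, S_k, S_l)` with `det u = qⱼ(4qᵢqⱼ − βᵢⱼ²)`, `β(u,·) = 2qⱼβᵢ· − βᵢⱼβⱼ·`. [folklore] -/
theorem W_expand (qi qj qk ql cij cik cil cjk cjl ckl : ℝ) :
    4 * (qj * (4 * qi * qj - cij ^ 2)) * qk * ql
      + (2 * qj * cik - cij * cjk) * ckl * (2 * qj * cil - cij * cjl)
      - qj * (4 * qi * qj - cij ^ 2) * ckl ^ 2 - qk * (2 * qj * cil - cij * cjl) ^ 2
      - ql * (2 * qj * cik - cij * cjk) ^ 2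
    = 16 * qi * qj ^ 2 * qk * ql - 4 * qi * qj ^ 2 * ckl ^ 2 - 4 * qj * qk * ql * cij ^ 2 + qj * cij ^ 2 * ckl ^ 2
      - 4 * qj ^ 2 * ql * cik ^ 2 + 4 * qj * ql * cij * cik * cjk - ql * cij ^ 2 * cjk ^ 2
      + 4 * qj ^ 2 * cik * cil * ckl - 2 * qj * cij * cik * cjl * ckl - 2 * qj * cij * cil * cjk * ckl
      + cij ^ 2 * cjk * cjl * ckl
      - 4 * qj ^ 2 * qk * cil ^ 2 + 4 * qj * qk * cij * cil * cjl - qk * cij ^ 2 * cjl ^ 2 := by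
  ring

/-- `W ≥ 0` in entries: `G3` of the derived letter `u = 2qⱼSᵢ − βᵢⱼSⱼ` with `Sₖ, Sₗ`. [folklore] -/
theorem pval_W (S : Fin 6 → Matrix (Fin 2) (Fin 2) ℝ) {i j k l : ℕ} (hij : i ≠ j) (hik : i ≠ k) (hil : i ≠ l)
    (hjk : j ≠ k) (hjl : j ≠ l) (hkl : k < l) : 0 ≤ pval (aval S) (Wpoly i j k l) := by
  have e : pval (aval S) (Wpoly i j k l)
      = 16 * qv S i * qv S j ^ 2 * qv S k * qv S l - 4 * qv S i * qv S j ^ 2 * bv S k l ^ 2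
        - 4 * qv S j * qv S k * qv S l * bv S i j ^ 2 + qv S j * bv S i j ^ 2 * bv S k l ^ 2
        - 4 * qv S j ^ 2 * qv S l * bv S i k ^ 2 + 4 * qv S j * qv S l * bv S i j * bv S i k * bv S j k
        - qv S l * bv S i j ^ 2 * bv S j k ^ 2
        + 4 * qv S j ^ 2 * bv S i k * bv S i l * bv S k l - 2 * qv S j * bv S i j * bv S i k * bv S j l * bv S k l
        - 2 * qv S j * bv S i j * bv S i l * bv S j k * bv S k l + bv S i j ^ 2 * bv S j k * bv S j l * bv S k l
        - 4 * qv S j ^ 2 * qv S k * bv S i l ^ 2 + 4 * qv S j * qv S k * bv S i j * bv S i l * bv S j l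
        - qv S k * bv S i j ^ 2 * bv S j l ^ 2 := by
    simp only [pval, tval, Wpoly, List.map_cons, List.map_nil, List.sum_cons, List.sum_nil, List.prod_cons,
      List.prod_nil, aval_qA, aval_cA S hij, aval_cA S hik, aval_cA S hil, aval_cA S hjk, aval_cA S hjl,
      aval_cA S hkl.ne]
    push_cast; ring
  rw [e, ← W_expand]
  have h := g3_nonneg (2 * qv S j * S (fin6 i) 0 0 - bv S i j * S (fin6 j) 0 0)
    (2 * qv S j * S (fin6 i) 0 1 - bv S i j * S (fin6 j) 0 1) (2 * qv S j * S (fin6 i) 1 1 - bv S i j * S (fin6 j) 1 1)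
    (S (fin6 k) 0 0) (S (fin6 k) 0 1) (S (fin6 k) 1 1) (S (fin6 l) 0 0) (S (fin6 l) 0 1) (S (fin6 l) 1 1)
  have hdet : (2 * qv S j * S (fin6 i) 0 0 - bv S i j * S (fin6 j) 0 0) * (2 * qv S j * S (fin6 i) 1 1 - bv S i j * S (fin6 j) 1 1)
      - (2 * qv S j * S (fin6 i) 0 1 - bv S i j * S (fin6 j) 0 1) ^ 2
      = qv S j * (4 * qv S i * qv S j - bv S i j ^ 2) := by
    unfold qv bv; ring
  have hpk : (2 * qv S j * S (fin6 i) 0 0 - bv S i j * S (fin6 j) 0 0) * S (fin6 k) 1 1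
      + (2 * qv S j * S (fin6 i) 1 1 - bv S i j * S (fin6 j) 1 1) * S (fin6 k) 0 0
      - 2 * ((2 * qv S j * S (fin6 i) 0 1 - bv S i j * S (fin6 j) 0 1) * S (fin6 k) 0 1)
      = 2 * qv S j * bv S i k - bv S i j * bv S j k := by
    unfold bv; ring
  have hpl : (2 * qv S j * S (fin6 i) 0 0 - bv S i j * S (fin6 j) 0 0) * S (fin6 l) 1 1
      + (2 * qv S j * S (fin6 i) 1 1 - bv S i j * S (fin6 j) 1 1) * S (fin6 l) 0 0
      - 2 * ((2 * qv S j * S (fin6 i) 0 1 - bv S i j * S (fin6 j) 0 1) * S (fin6 l) 0 1)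
      = 2 * qv S j * bv S i l - bv S i j * bv S j l := by
    unfold bv; ring
  rw [hdet, hpk, hpl] at h
  have hqk : S (fin6 k) 0 0 * S (fin6 k) 1 1 - S (fin6 k) 0 1 ^ 2 = qv S k := rfl
  have hql : S (fin6 l) 0 0 * S (fin6 l) 1 1 - S (fin6 l) 0 1 ^ 2 = qv S l := rfl
  have hckl : S (fin6 k) 0 0 * S (fin6 l) 1 1 + S (fin6 k) 1 1 * S (fin6 l) 0 0 - 2 * (S (fin6 k) 0 1 * S (fin6 l) 0 1)
      = bv S k l := rfl
  rw [hqk, hql, hckl] at h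
  linarith

/-- No odd definite triangle: three definite letters have pairwise `β` with positive product. [folklore] -/
theorem tri_pos (S : Fin 6 → Matrix (Fin 2) (Fin 2) ℝ) {i j k : ℕ} (hij : i < j) (hjk : j < k)
    (hi : 0 < aval S (qA i)) (hj : 0 < aval S (qA j)) (hk : 0 < aval S (qA k)) :
    0 < aval S (cA i j) * aval S (cA j k) * aval S (cA i k) := by
  rw [aval_qA] at hi hj hk
  rw [aval_cA S hij.ne, aval_cA S hjk.ne, aval_cA S (hij.trans hjk).ne]
  have h := polarDet_triangle_pos (S (fin6 i) 0 0) (S (fin6 i) 0 1) (S (fin6 i) 1 1) (S (fin6 j) 0 0) (S (fin6 j) 0 1)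
    (S (fin6 j) 1 1) (S (fin6 k) 0 0) (S (fin6 k) 0 1) (S (fin6 k) 1 1)
    (by unfold qv at hi; exact hi) (by unfold qv at hj; exact hj) (by unfold qv at hk; exact hk)
  unfold bv
  exact h

end Twenty

end Summit.ValiantsHypothesis.ValiantsHypothesis.Theorems.LacunarySymmetroidMatrixDescartes.Census.V20
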